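import Literature.NumberTheory.PAdicHodge.LubinTateWittTwistEigenvector
import Literature.NumberTheory.PAdicHodge.UnramifiedWittEmbeddingClassification
import HarnessLib

/-!
# Conjugates of the Lubin–Tate character are `ℂ_F`-admissible — general `F`, from an Eisenstein datum

Topic `Literature/NumberTheory/PAdicHodge`; THEOREMS only (solo-Langlands-informed Stage E2.10b). Let `F/ℚ_p` be finite,
`π` a uniformizer, `χ_π : Γ_F → 𝒪_F^×` the Lubin–Tate character and `e : F → F̄` a `ℚ_p`-embedding, `e ≠ id`. The tree
theorem `lubinTateCharacterConjugateAdmissible_of_twistClassification` (`LubinTateWittTwistEigenvector`) produces a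
period `u ∈ ℂ_F^×` with `σ(u) = e(χ_π(σ))·u` for `σ ∈ Γ_M` (`M ⊇` all conjugates of `F`) from a `W(k_F)`-Eisenstein datum
`D` for `π` together with three inputs: (CL) the classification of `e` on `𝒪_D = W(k_F)[π]` (`e = θ ∘ φ^j` on `W(k_F)`,
`e(π) = ρ` a root of the conjugate polynomial `D.poly^{(φ^j)}`), (N) `‖e π‖ = ‖π‖`, and (S) `χ_π(Γ_F) ⊆ 𝒪_D`.

This file discharges (CL) and (N) for EVERY `p`-adic field `F`:

* (N) is the isometry of `ℚ_p`-embeddings, `norm_coe_algHom_eq` (tree `UnramifiedWittEmbeddingClassification`);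
* (CL): by `exists_algHom_eq_twistCoeff` (loc. cit.) `e|_{W(k_F)} = c_j = θ ∘ φ^j` for some `j < f`; then
  `e(g(π)) = g^{(φ^j)}(e π)` for every `g ∈ W(k_F)[X]` (`coe_algHom_eval₂_eq`), so `ρ := e(π) ∈ 𝒪_{ℂ_F}` is a root of
  `D.poly^{(φ^j)}` and `e = (a ↦ a^{(φ^j)}(ρ))` on `𝒪_D`; and if `j = 0` and `e π = π` then `e = id` on `𝒪_D = 𝒪_F`
  (`eqOn_integer_of_wittFixedToF_of_unif`, using the surjectivity `𝒪_D ↠ 𝒪_F`), hence on `F = Frac 𝒪_F`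
  (`algHom_eq_toAlgHom_of_forall_mem_integer`), contradicting `e ≠ id`.

Main result ★ `lubinTateCharacterConjugateAdmissible_of_coeff_surjective`: for a `W(k_F)`-Eisenstein datum `D` with
`D.unif = π` and `𝒪_D → 𝒪_F` surjective (i.e. `𝒪_F = W(k_F)[π]`, Serre II §5 Thm. 4 + I §6 Prop. 18),
`LubinTateCharacterConjugateAdmissible F p hp hπ` holds; `…_of_coeff_surjective'` is the instance-free form.

## References
* J.-P. Serre, *Local Fields* (1979), Ch. I §6 Prop. 17–18, Ch. II §5 Thm. 4, Ch. III §5 Thm. 3. [SerreLocalFields1979]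
* J.-M. Fontaine, *Le corps des périodes p-adiques*, Astérisque 223 (1994), Exp. II §1.2, §1.5. [FontaineAsterisque223III]
* P. Colmez, *Périodes des variétés abéliennes à multiplication complexe*, Ann. of Math. 138 (1993), §I.2
  (periods of Lubin–Tate characters). [Colmez1993]
-/

noncomputable section

open IsLocalRing WittVector Polynomial

namespace Literature.NumberTheory.PAdicHodge

open Literature.NumberTheory.GaloisRepresentations
open Literature.NumberTheory.GaloisRepresentations.IsNonarchimedeanLocalField
open Field ValuativeRel

variable {F : Type} [Field F] [ValuativeRel F] [TopologicalSpace F] [IsNonarchimedeanLocalField F] [CharZero F]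
  {p : ℕ} [Fact p.Prime]

/-! ## §1 `ℚ_p`-embeddings agreeing with the inclusion on `𝒪_F`, or on `W(k_F)[π]` -/

/-- **A `ℚ_p`-embedding `e : F → F̄` which is the inclusion on `𝒪_F` is the inclusion** (`F = 𝒪_F ∪ (𝒪_F)⁻¹`).
[cite: SerreLocalFields1979, Ch. II §5 Thm. 4] -/
theorem algHom_eq_toAlgHom_of_forall_mem_integer (hp : valuation F p < 1)
    (e : F →ₐ[PadicBase F p hp] NormedAlgClosure F) (h : ∀ y ∈ 𝒪[F], e y = algebraMap F (NormedAlgClosure F) y) :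
    e = IsScalarTower.toAlgHom (PadicBase F p hp) F (NormedAlgClosure F) := by
  refine AlgHom.ext fun x => ?_
  rw [IsScalarTower.toAlgHom_apply]
  by_cases hx : x ∈ 𝒪[F]
  · exact h x hx
  · letI := nontriviallyNormedField F
    have h1 : 1 < ‖x‖ := not_le.1 fun h' => hx ((norm_le_one_iff F x).1 h')
    have hinv : x⁻¹ ∈ 𝒪[F] :=
      (norm_le_one_iff F x⁻¹).1 (by rw [norm_inv]; exact inv_le_one_of_one_le₀ h1.le)
    have h2 := h x⁻¹ hinv
    rw [map_inv₀, map_inv₀] at h2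
    exact inv_injective h2

/-- **A `ℚ_p`-embedding which is the inclusion on `W(k_F)` and fixes `π` is the inclusion on `𝒪_F`**, provided
`𝒪_F = W(k_F)[π]` (surjectivity of `𝒪_D → 𝒪_F` for an Eisenstein datum `D` with root `π`).
[cite: SerreLocalFields1979, Ch. I §6 Prop. 18] -/
theorem eqOn_integer_of_wittFixedToF_of_unif {hp : valuation F p < 1} (D : EisensteinRootW F p hp)
    (hsurj : Function.Surjective (EisensteinRootW.Coeff.toInt D)) (e : F →ₐ[PadicBase F p hp] NormedAlgClosure F)
    (hfix : ∀ w : wittFixed F p, e (wittFixedToF F p hp w) = algebraMap F (NormedAlgClosure F) (wittFixedToF F p hp w))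
    (hunif : e D.unif = algebraMap F (NormedAlgClosure F) D.unif) :
    ∀ y ∈ 𝒪[F], e y = algebraMap F (NormedAlgClosure F) y := by
  have hcomp : (e : F →+* NormedAlgClosure F).comp (wittFixedToF F p hp) =
      (algebraMap F (NormedAlgClosure F)).comp (wittFixedToF F p hp) :=
    RingHom.ext fun w => by rw [RingHom.comp_apply, RingHom.comp_apply, RingHom.coe_coe, hfix]
  have key : ∀ a : D.Coeff,
      e (EisensteinRootW.Coeff.toF D a) = algebraMap F (NormedAlgClosure F) (EisensteinRootW.Coeff.toF D a) := by
    intro a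
    induction a using AdjoinRoot.induction_on with
    | ih g =>
      rw [EisensteinRootW.Coeff.toF_mk]
      have h1 := Polynomial.hom_eval₂ g (wittFixedToF F p hp) (e : F →+* NormedAlgClosure F) D.unif
      have h2 := Polynomial.hom_eval₂ g (wittFixedToF F p hp) (algebraMap F (NormedAlgClosure F)) D.unif
      rw [hcomp, RingHom.coe_coe, hunif] at h1
      exact h1.trans h2.symm
  intro y hy
  obtain ⟨a, ha⟩ := hsurj ⟨y, hy⟩
  have hya : EisensteinRootW.Coeff.toF D a = y := by
    have h := congrArg Subtype.val ha
    rw [EisensteinRootW.Coeff.coe_toInt] at h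
    exact h
  rw [← hya]
  exact key a

/-! ## §2 Transport of polynomial identities along the classification `e|_{W(k_F)} = θ ∘ φ^j` -/

set_option maxHeartbeats 2000000 in
/-- **`e(g(x)) = g^{(φ^j)}(ρ)` in `ℂ_F`** for `g ∈ W(k_F)[X]`, when `e = c_j` on `W(k_F)` and `ρ = e(x)`.
[cite: FontaineAsterisque223III, Exp. II §1.2] -/
theorem coe_algHom_eval₂_eq [Fact (¬ IsUnit (p : integerC F))]
    [IsAdicComplete (Ideal.span {(p : integerC F)}) (integerC F)] (hp : valuation F p < 1)
    (e : F →ₐ[PadicBase F p hp] NormedAlgClosure F) {j : ℕ}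
    (hj : ∀ w : wittFixed F p, ((e (wittFixedToF F p hp w) : NormedAlgClosure F) : CompletedAlgClosure F) =
      ((twistCoeff hp j w : integerC F) : CompletedAlgClosure F))
    {x : F} {ρ : integerC F} (hρ : (ρ : CompletedAlgClosure F) = ((e x : NormedAlgClosure F) : CompletedAlgClosure F))
    (g : (wittFixed F p)[X]) :
    ((e (g.eval₂ (wittFixedToF F p hp) x) : NormedAlgClosure F) : CompletedAlgClosure F) =
      ((g.eval₂ (twistCoeff hp j) ρ : integerC F) : CompletedAlgClosure F) := by
  have hcomp : (((UniformSpace.Completion.coeRingHom : NormedAlgClosure F →+* CompletedAlgClosure F).comp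
      (e : F →+* NormedAlgClosure F)).comp (wittFixedToF F p hp)) = (integerC F).subtype.comp (twistCoeff hp j) :=
    RingHom.ext fun w => by
      rw [RingHom.comp_apply, RingHom.comp_apply, RingHom.comp_apply, RingHom.coe_coe, Subring.coe_subtype]
      exact hj w
  have h1 := Polynomial.hom_eval₂ g (wittFixedToF F p hp)
    ((UniformSpace.Completion.coeRingHom : NormedAlgClosure F →+* CompletedAlgClosure F).comp
      (e : F →+* NormedAlgClosure F)) x
  have h2 := Polynomial.hom_eval₂ g (twistCoeff hp j) (integerC F).subtype ρ
  have h3 : ∀ y : F, ((UniformSpace.Completion.coeRingHom : NormedAlgClosure F →+* CompletedAlgClosure F).comp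
      (e : F →+* NormedAlgClosure F)) y = ((e y : NormedAlgClosure F) : CompletedAlgClosure F) := fun y => rfl
  rw [hcomp, h3, h3, ← hρ] at h1
  exact h1.trans h2.symm

/-! ## §3 ★ The conjugates of the Lubin–Tate character are `ℂ_F`-admissible (general `F`) -/

set_option maxHeartbeats 2000000 in
/-- ★★ **`LubinTateCharacterConjugateAdmissible F p hp hπ` from a `W(k_F)`-Eisenstein datum generating `𝒪_F`.** For a
`p`-adic field `F` with `q_F = p^f`, a uniformizer `π`, and an Eisenstein datum `D` over `W(k_F)` with root `π` such that
`W(k_F)[π] → 𝒪_F` is onto: for every finite `M ⊇` (conjugates of `F`) and every `ℚ_p`-embedding `e ≠ id` of `F` there is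
`u ∈ ℂ_F^×` with `σ(u) = e(χ_π(σ))·u` for all `σ ∈ Γ_M`. Inputs: the twisted-period theorem
`lubinTateCharacterConjugateAdmissible_of_twistClassification`, the classification `exists_algHom_eq_twistCoeff` of `e` on
`W(k_F)`, and the isometry `norm_coe_algHom_eq`. [cite: FontaineAsterisque223III, Exp. II §1.5; Colmez1993, §I.2] -/
theorem lubinTateCharacterConjugateAdmissible_of_coeff_surjective [Fact (¬ IsUnit (p : integerC F))]
    [IsAdicComplete (Ideal.span {(p : integerC F)}) (integerC F)] {hp : valuation F p < 1} (D : EisensteinRootW F p hp)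
    {π : 𝒪[F]} (hπ : (valuation F).IsUniformizer (π : F)) (hπD : (π : F) = D.unif) {f : ℕ}
    (hq : residueFieldCard F = p ^ f) (hsurj : Function.Surjective (EisensteinRootW.Coeff.toInt D)) :
    LubinTateCharacterConjugateAdmissible F p hp hπ := by
  refine lubinTateCharacterConjugateAdmissible_of_twistClassification D hπ hπD hq ?_
    (fun e => norm_coe_algHom_eq hp e D.unif) (fun σ => hsurj _)
  intro e he
  obtain ⟨j, hjf, hj⟩ := exists_algHom_eq_twistCoeff hp hq e
  obtain ⟨ρ, hρ⟩ : ∃ ρ : integerC F,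
      (ρ : CompletedAlgClosure F) = ((e D.unif : NormedAlgClosure F) : CompletedAlgClosure F) :=
    ⟨⟨((e D.unif : NormedAlgClosure F) : CompletedAlgClosure F),
      (mem_integerC_iff).2 (norm_coe_algHom_le_one hp e D.unif_mem_integer)⟩, rfl⟩
  have hev := coe_algHom_eval₂_eq hp e hj hρ
  have hroot : D.poly.eval₂ (twistCoeff hp j) ρ = 0 := by
    apply Subtype.ext
    rw [← hev D.poly, D.eval₂_unif, map_zero, UniformSpace.Completion.coe_zero]
    rfl
  refine ⟨j, hjf, ρ, hroot, hρ, ?_, fun a => ?_⟩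
  · -- `j = 0` and `e π = π` force `e = id`
    intro hj0 hρπ
    apply he
    subst hj0
    refine algHom_eq_toAlgHom_of_forall_mem_integer hp e (eqOn_integer_of_wittFixedToF_of_unif D hsurj e ?_ ?_)
    · intro w
      apply UniformSpace.Completion.coe_injective (NormedAlgClosure F)
      rw [hj w, twistCoeff_zero, coe_wittFixedToIntC, CompletedAlgClosure.algebraMap_eq_coe]
    · apply UniformSpace.Completion.coe_injective (NormedAlgClosure F)
      rw [← hρ, hρπ, CompletedAlgClosure.algebraMap_eq_coe]
  · induction a using AdjoinRoot.induction_on with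
    | ih g => rw [EisensteinRootW.Coeff.toF_mk, AdjoinRoot.lift_mk, hev g]

/-- ★★ **Instance-free form**: for every `p`-adic field `F`, every uniformizer `π` admitting a `W(k_F)`-Eisenstein datum `D`
with `D.unif = π` and `W(k_F)[π] ↠ 𝒪_F`, `LubinTateCharacterConjugateAdmissible F p hp hπ` holds.
[cite: FontaineAsterisque223III, Exp. II §1.5; Colmez1993, §I.2] -/
theorem lubinTateCharacterConjugateAdmissible_of_coeff_surjective' {hp : valuation F p < 1} (D : EisensteinRootW F p hp)
    {π : 𝒪[F]} (hπ : (valuation F).IsUniformizer (π : F)) (hπD : (π : F) = D.unif)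
    (hsurj : Function.Surjective (EisensteinRootW.Coeff.toInt D)) :
    LubinTateCharacterConjugateAdmissible F p hp hπ := by
  haveI : Fact (¬ IsUnit (p : integerC F)) := ⟨not_isUnit_natCast_integerC hp⟩
  haveI : IsAdicComplete (Ideal.span {(p : integerC F)}) (integerC F) := isAdicComplete_integerC_natCast hp
  obtain ⟨f, hf0, hq⟩ := exists_residueFieldCard_eq_pow hp
  exact lubinTateCharacterConjugateAdmissible_of_coeff_surjective D hπ hπD hq hsurj

end Literature.NumberTheory.PAdicHodge

end
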